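import Literature.Analysis.Complex.PQExhaustion
import Literature.Analysis.Complex.PQTypeZeroHolomorphic
import Literature.Analysis.Complex.PolydiscApprox
import Mathlib.Analysis.Calculus.SmoothSeries
import Mathlib.Analysis.Calculus.ContDiff.Bounds
import Mathlib.Analysis.Calculus.ContDiff.RestrictScalars
import HarnessLib

/-!
# `∂̄`-exhaustion of a polydisc for `(p,1)`-forms (Hörmander, proof of Thm. 2.7.8, case `q = 0`)

The remaining bidegree of `Literature/Analysis/Complex/PQExhaustion.lean`: for data `α` of type
`(p,1)` on a polydisc `D ⊆ ℂ^ι` (`C^∞` on `D`, `(dα)^{p,2} = 0` on `D`) there is a potential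
`β`, `C^∞` on `D`, of type `(p,0)`, with `(dβ)^{p,1} = α` on all of `D`
(`exists_dbar_potential_on_polydisc_zero`).

As in Hörmander's proof of Thm. 2.7.8 (`q = 0`): exhaust `D` by `D_m = D(c, r - 1/(m+1))`, take
potentials `B_m` on `D_m` (Thm. 2.3.3, `exists_dbar_potential_of_type`); the differences
`δ_m = B_{m+2} - β̃_m` are `∂̄`-closed `(p,0)`-forms, i.e. HOLOMORPHIC maps `ℂ^ι → Λ^p` on
`D_{m+1}` (`differentiableOn_complex_of_typeZero`), which are approximated by entire maps `g_m`
(Taylor polynomials, `exists_entire_approx_on_closedPolydisc`) so well that, by the Cauchy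
estimates (`SCV.norm_iteratedFDeriv_le_of_closedBall`), all derivatives of order `≤ m` of
`u_m = δ_m - (g_m)^{p,0}` are `≤ 2⁻ᵐ` on `D_m`; then `β̃_{m+1} = B_{m+2} - (g_m)^{p,0}` still solves
`∂̄β̃_{m+1} = α` on `D_{m+2}` and `β = β̃_0 + ∑_m u_m` converges with all derivatives locally
uniformly on `D` (`contDiff_tsum_of_eventually` after a cut-off), with
`∂̄β = α + ∑ ∂̄u_m = α` (`hasFDerivAt_tsum`; the `u_m` are holomorphic near each point for `m`
large).

## References

* L. Hörmander, *An Introduction to Complex Analysis in Several Variables*, 2nd ed. (1973),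
  Thm. 2.3.3, Thm. 2.2.7, proof of Thm. 2.7.8. [HormanderSCV1973]
-/

noncomputable section

open scoped ComplexConjugate ContDiff Topology
open Complex Function ContinuousAlternatingMap Set Filter Metric
open Literature.LinearAlgebra.Alternating

namespace Literature.Analysis.Complex

variable {ι : Type*} [Fintype ι] [DecidableEq ι]

/-! ### Cauchy estimates in real form -/

section Cauchy

variable {F : Type*} [NormedAddCommGroup F] [NormedSpace ℂ F] [CompleteSpace F]

omit [DecidableEq ι] in
/-- **Cauchy estimate, all orders, real derivatives**: if `u : ℂ^ι → F` is holomorphic on an open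
`U ⊇ closedBall x ρ` (sup norm) and `‖u‖ ≤ M` on that ball, then for `1 ≤ j`,
`‖Dʲu(x)‖ ≤ M / (ρ/j)ʲ` for the REAL iterated derivative (which is the complex one with scalars
restricted). [cite: HormanderSCV1973, Thm. 2.2.7] -/
theorem norm_iteratedFDeriv_real_le_of_closedBall {u : (ι → ℂ) → F} {U : Set (ι → ℂ)}
    (hu : DifferentiableOn ℂ u U) (hU : IsOpen U) {x : ι → ℂ} {ρ M : ℝ} (hρ : 0 < ρ)
    (hρU : closedBall x ρ ⊆ U) (hM : ∀ z ∈ closedBall x ρ, ‖u z‖ ≤ M) {j : ℕ} (hj : 1 ≤ j) :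
    ‖iteratedFDeriv ℝ j u x‖ ≤ M / (ρ / j) ^ j := by
  have hx : x ∈ U := hρU (mem_closedBall_self hρ.le)
  have hC : ContDiffAt ℂ j u x :=
    ((SCV.contDiffOn_infty hu hU).of_le (by exact_mod_cast le_top)).contDiffAt (hU.mem_nhds hx)
  rw [← hC.restrictScalars_iteratedFDeriv (𝕜 := ℝ), Function.comp_apply,
    ContinuousMultilinearMap.norm_restrictScalars]
  have hjpos : (0 : ℝ) < j := by exact_mod_cast hj
  refine SCV.norm_iteratedFDeriv_le_of_closedBall hu hU hρU hM (div_pos hρ hjpos) j ?_ ?_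
  · rw [mul_div_cancel₀ _ hjpos.ne']
  · rw [mul_div_cancel₀ _ hjpos.ne', sub_self]
    exact mem_closedBall_self le_rfl

omit [DecidableEq ι] [CompleteSpace F] in
/-- Order `0`: the bound itself. [folklore] -/
theorem norm_iteratedFDeriv_real_zero_le {u : (ι → ℂ) → F} {x : ι → ℂ} {M : ℝ} (hM : ‖u x‖ ≤ M) :
    ‖iteratedFDeriv ℝ 0 u x‖ ≤ M := by
  rwa [norm_iteratedFDeriv_zero]

end Cauchy

/-! ### The correction step: entire approximation with control of `m` derivatives -/

section Correction

variable {n p : ℕ}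

omit [DecidableEq ι] in
/-- **Holomorphic `(p,0)`-maps on a polydisc are approximated by entire ones to any order on
smaller closed polydiscs**: if `δ : ℂ^ι → Λ^n` is holomorphic on `D(c, R)`, `t i + κ < R i` with
`κ > 0`, then for all `N` and `ε > 0` there is an entire `g` such that `u = δ - (g)^{p,0}`
satisfies `‖Dʲu‖ ≤ ε` on the closed polydisc of radii `t` for all `j ≤ N` (real derivatives).
Proof: uniform approximation on the closed polydisc of radii `t + κ`
(`exists_entire_approx_on_closedPolydisc`) and the Cauchy estimates on balls of radius `κ`.
[cite: HormanderSCV1973, Thm. 2.2.7] -/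
theorem exists_entire_correction {δ : (ι → ℂ) → (ι → ℂ) [⋀^Fin n]→L[ℝ] ℂ} {c : ι → ℂ} {R t : ι → ℝ}
    (hδ : DifferentiableOn ℂ δ (polydisc c R)) (hδt : ∀ x, typeProjAt p 0 (δ x) = δ x) {κ : ℝ}
    (hκ : 0 < κ) (ht : ∀ i, t i + κ < R i) (N : ℕ) {ε : ℝ} (hε : 0 < ε) :
    ∃ g : (ι → ℂ) → (ι → ℂ) [⋀^Fin n]→L[ℝ] ℂ, Differentiable ℂ g ∧
      ∀ j ≤ N, ∀ x ∈ Set.pi univ (fun i => closedBall (c i) (t i)),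
        ‖iteratedFDeriv ℝ j (fun y => δ y - typeProjAt p 0 (g y)) x‖ ≤ ε := by
  -- constants: `L = ∑_{j ≤ N} (j/κ)^j + 1` and the norm of the projection
  set P : ((ι → ℂ) [⋀^Fin n]→L[ℝ] ℂ) →L[ℂ] ((ι → ℂ) [⋀^Fin n]→L[ℝ] ℂ) := typeProjL p 0 with hP
  set L : ℝ := ∑ j ∈ Finset.range (N + 1), ((j : ℝ) / κ) ^ j + 1 with hL
  have hL1 : 1 ≤ L := by
    have : 0 ≤ ∑ j ∈ Finset.range (N + 1), ((j : ℝ) / κ) ^ j :=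
      Finset.sum_nonneg fun j _ => by positivity
    linarith
  have hL0 : 0 < L := one_pos.trans_le hL1
  set η : ℝ := ε / (L * (‖P‖ + 1)) with hη
  have hη0 : 0 < η := by positivity
  -- uniform approximation on the larger closed polydisc
  obtain ⟨g, hg, hga⟩ := exists_entire_approx_on_closedPolydisc (t := fun i => t i + κ) hδ ht hη0
  refine ⟨g, hg, fun j hj x hx => ?_⟩
  -- `u = P ∘ (δ - g)` is holomorphic on `D(c,R)` and small on the larger closed polydisc
  set w : (ι → ℂ) → (ι → ℂ) [⋀^Fin n]→L[ℝ] ℂ := fun y => δ y - g y with hw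
  have hwu : (fun y => δ y - typeProjAt p 0 (g y)) = P ∘ w := by
    funext y
    simp only [hw, Function.comp_apply, hP, map_sub, typeProjL_apply, hδt]
  have hwd : DifferentiableOn ℂ w (polydisc c R) := hδ.sub hg.differentiableOn
  have hball : closedBall x κ ⊆ Set.pi univ (fun i => closedBall (c i) (t i + κ)) := by
    intro y hy i _
    rw [mem_closedBall, dist_eq_norm] at hy ⊢
    have h1 : ‖y i - x i‖ ≤ κ := (norm_le_pi_norm (y - x) i).trans hy
    have h2 : ‖x i - c i‖ ≤ t i := by
      have := hx i (mem_univ i); rwa [mem_closedBall, dist_eq_norm] at this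
    calc ‖y i - c i‖ = ‖(y i - x i) + (x i - c i)‖ := by rw [sub_add_sub_cancel]
      _ ≤ κ + t i := (norm_add_le _ _).trans (add_le_add h1 h2)
      _ = t i + κ := add_comm _ _
  have hballR : closedBall x κ ⊆ polydisc c R := fun y hy =>
    mem_polydisc.2 fun i => mem_ball.2 (lt_of_le_of_lt (mem_closedBall.1 (hball hy i (mem_univ i))) (ht i))
  have hwM : ∀ z ∈ closedBall x κ, ‖w z‖ ≤ η := fun z hz => hga z (hball hz)
  -- Cauchy estimate for `w`, then the projection
  have hxR : x ∈ polydisc c R := hballR (mem_closedBall_self hκ.le)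
  have hwC : ContDiffAt ℝ N w x :=
    (((SCV.contDiffOn_infty hwd (isOpen_polydisc c R)).of_le (by exact_mod_cast le_top)).contDiffAt
      ((isOpen_polydisc c R).mem_nhds hxR)).restrict_scalars ℝ
  have hjw : ‖iteratedFDeriv ℝ j w x‖ ≤ η * L := by
    rcases Nat.eq_zero_or_pos j with rfl | hjp
    · rw [norm_iteratedFDeriv_zero]
      calc ‖w x‖ ≤ η := hwM x (mem_closedBall_self hκ.le)
        _ = η * 1 := (mul_one η).symm
        _ ≤ η * L := by gcongr
    · calc ‖iteratedFDeriv ℝ j w x‖ ≤ η / (κ / j) ^ j :=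
            norm_iteratedFDeriv_real_le_of_closedBall hwd (isOpen_polydisc c R) hκ hballR hwM hjp
        _ = η * ((j : ℝ) / κ) ^ j := by rw [div_eq_mul_inv, ← inv_pow, inv_div]
        _ ≤ η * L := by
            gcongr
            have hmem : j ∈ Finset.range (N + 1) := Finset.mem_range.2 (Nat.lt_succ_of_le hj)
            calc ((j : ℝ) / κ) ^ j ≤ ∑ j ∈ Finset.range (N + 1), ((j : ℝ) / κ) ^ j :=
                  Finset.single_le_sum (f := fun j : ℕ => ((j : ℝ) / κ) ^ j)
                    (fun i _ => by positivity) hmem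
              _ ≤ L := by linarith
  rw [hwu]
  calc ‖iteratedFDeriv ℝ j (P ∘ w) x‖
      = ‖iteratedFDeriv ℝ j ((P.restrictScalars ℝ) ∘ w) x‖ := rfl
    _ ≤ ‖P.restrictScalars ℝ‖ * ‖iteratedFDeriv ℝ j w x‖ :=
        (P.restrictScalars ℝ).norm_iteratedFDeriv_comp_left hwC (by exact_mod_cast hj)
    _ ≤ (‖P‖ + 1) * (η * L) := by
        gcongr
        exact (P.norm_restrictScalars (𝕜' := ℝ)).le.trans (le_add_of_nonneg_right zero_le_one)
    _ = ε := by rw [hη]; field_simp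

end Correction

/-! ### Smooth series with a cut-off -/

section Series

variable {G : Type*} [NormedAddCommGroup G] [NormedSpace ℂ G]

omit [DecidableEq ι] in
/-- **Leibniz bound for a cut-off product**: if `‖Dⁱχ‖ ≤ C i` everywhere and `‖Dⁱu‖ ≤ a` on a set
`K ⊇ tsupport χ` for `i ≤ j`, then `‖Dʲ(χ • u)‖ ≤ (∑_{i≤j} (j choose i) C i) a` everywhere
(`norm_iteratedFDeriv_smul_le`; off `tsupport χ` the product vanishes identically near the point).
[folklore] -/
theorem norm_iteratedFDeriv_smul_cutoff_le {u : (ι → ℂ) → G} (hu : ContDiff ℝ ∞ u) {χ : (ι → ℂ) → ℂ}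
    (hχ : ContDiff ℝ ∞ χ) {C : ℕ → ℝ} (hC : ∀ i x, ‖iteratedFDeriv ℝ i χ x‖ ≤ C i) {K : Set (ι → ℂ)}
    (hK : tsupport χ ⊆ K) {a : ℝ} (ha0 : 0 ≤ a) {j : ℕ}
    (hb : ∀ i ≤ j, ∀ x ∈ K, ‖iteratedFDeriv ℝ i u x‖ ≤ a) (x : ι → ℂ) :
    ‖iteratedFDeriv ℝ j (fun y => χ y • u y) x‖ ≤
      (∑ i ∈ Finset.range (j + 1), (j.choose i : ℝ) * C i) * a := by
  have hC0 : ∀ i, 0 ≤ C i := fun i => (norm_nonneg _).trans (hC i x)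
  by_cases hx : x ∈ tsupport χ
  · calc ‖iteratedFDeriv ℝ j (fun y => χ y • u y) x‖
        ≤ ∑ i ∈ Finset.range (j + 1),
            (j.choose i : ℝ) * ‖iteratedFDeriv ℝ i χ x‖ * ‖iteratedFDeriv ℝ (j - i) u x‖ :=
          norm_iteratedFDeriv_smul_le hχ hu x (by exact_mod_cast le_top)
      _ ≤ ∑ i ∈ Finset.range (j + 1), (j.choose i : ℝ) * C i * a := by
          refine Finset.sum_le_sum fun i _ => ?_
          exact mul_le_mul (mul_le_mul_of_nonneg_left (hC i x) (Nat.cast_nonneg _))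
            (hb (j - i) (Nat.sub_le j i) x (hK hx)) (norm_nonneg _)
            (mul_nonneg (Nat.cast_nonneg _) (hC0 i))
      _ = (∑ i ∈ Finset.range (j + 1), (j.choose i : ℝ) * C i) * a := by rw [Finset.sum_mul]
  · have hx' : x ∉ tsupport (fun y => χ y • u y) := fun h => hx (tsupport_smul_subset_left _ _ h)
    have h0 : iteratedFDeriv ℝ j (fun y => χ y • u y) x = 0 :=
      Function.notMem_support.mp fun h => hx' (support_iteratedFDeriv_subset j h)
    rw [h0, norm_zero]
    exact mul_nonneg (Finset.sum_nonneg fun i _ => mul_nonneg (Nat.cast_nonneg _) (hC0 i)) ha0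

variable [CompleteSpace G]

omit [DecidableEq ι] in
/-- **Cut-off series are `C^∞` with termwise derivative** (Weierstrass `M`-test in all orders):
if `u_m : ℂ^ι → G` are `C^∞` with `‖Dⁱu_m‖ ≤ a_m` on `K ⊇ tsupport χ` for all `i ≤ m + 1`, where
`∑ a_m < ∞` and `χ` is a `C^∞` compactly supported cut-off, then `T = ∑_m χ • u_m` is `C^∞`,
the series and the series of derivatives converge, and `DT(x) = ∑_m D(χ • u_m)(x)`
(`contDiff_tsum_of_eventually`, `hasFDerivAt_tsum`). [folklore] -/
theorem contDiff_tsum_smul_cutoff {u : ℕ → (ι → ℂ) → G} (hu : ∀ m, ContDiff ℝ ∞ (u m))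
    {χ : (ι → ℂ) → ℂ} (hχ : ContDiff ℝ ∞ χ) (hχc : HasCompactSupport χ) {K : Set (ι → ℂ)}
    (hK : tsupport χ ⊆ K) {a : ℕ → ℝ} (ha : Summable a) (ha0 : ∀ m, 0 ≤ a m)
    (hb : ∀ m, ∀ i ≤ m + 1, ∀ x ∈ K, ‖iteratedFDeriv ℝ i (u m) x‖ ≤ a m) :
    ContDiff ℝ ∞ (fun x => ∑' m, χ x • u m x) ∧
      (∀ x, Summable fun m => χ x • u m x) ∧
      (∀ x, Summable fun m => fderiv ℝ (fun y => χ y • u m y) x) ∧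
      ∀ x, HasFDerivAt (fun x => ∑' m, χ x • u m x)
        (∑' m, fderiv ℝ (fun y => χ y • u m y) x) x := by
  -- bounds for the derivatives of the cut-off
  have hCex : ∀ i, ∃ C, ∀ x, ‖iteratedFDeriv ℝ i χ x‖ ≤ C := fun i =>
    (hχc.iteratedFDeriv i).exists_bound_of_continuous
      (hχ.continuous_iteratedFDeriv (by exact_mod_cast le_top))
  choose C hC using hCex
  set Cj : ℕ → ℝ := fun j => ∑ i ∈ Finset.range (j + 1), (j.choose i : ℝ) * C i with hCj
  have hf : ∀ m, ContDiff ℝ ∞ (fun y => χ y • u m y) := fun m => hχ.smul (hu m)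
  have hbound : ∀ m j, j ≤ m + 1 → ∀ x, ‖iteratedFDeriv ℝ j (fun y => χ y • u m y) x‖ ≤ Cj j * a m :=
    fun m j hj x => norm_iteratedFDeriv_smul_cutoff_le (hu m) hχ hC hK (ha0 m)
      (fun i hi y hy => hb m i (hi.trans hj) y hy) x
  have h0 : ∀ x, Summable fun m => χ x • u m x := fun x =>
    Summable.of_norm_bounded (ha.mul_left (Cj 0)) fun m => by
      have := hbound m 0 (Nat.zero_le _) x
      rwa [norm_iteratedFDeriv_zero] at this
  have h1 : ∀ m x, ‖fderiv ℝ (fun y => χ y • u m y) x‖ ≤ Cj 1 * a m := fun m x => by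
    have : ‖fderiv ℝ (fun y => χ y • u m y) x‖ = ‖iteratedFDeriv ℝ 1 (fun y => χ y • u m y) x‖ := by
      rw [← norm_iteratedFDeriv_fderiv, norm_iteratedFDeriv_zero]
    rw [this]
    exact hbound m 1 (by omega) x
  refine ⟨?_, h0, fun x => Summable.of_norm_bounded (ha.mul_left (Cj 1)) fun m => h1 m x, fun x => ?_⟩
  · refine contDiff_tsum_of_eventually hf (v := fun j m => Cj j * a m) (fun j _ => ha.mul_left (Cj j))
      fun j _ => ?_
    rw [Nat.cofinite_eq_atTop, eventually_atTop]
    exact ⟨j, fun m hm x => hbound m j (by omega) x⟩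
  · exact hasFDerivAt_tsum (ha.mul_left (Cj 1)) (fun m y => ((hf m).differentiable (by simp) y).hasFDerivAt)
      h1 (h0 x) x

omit [Fintype ι] [DecidableEq ι] [CompleteSpace G] in
/-- If `T` has derivative `L = ∑_m L_m` (a convergent series of real-linear maps each commuting with
`i`), then `∂̄_v T = 0` for all `v`. [folklore] -/
theorem dbarAlong_eq_zero_of_hasFDerivAt_tsum {E : Type*} [NormedAddCommGroup E] [NormedSpace ℂ E]
    {T : E → G} {x : E} {L : ℕ → E →L[ℝ] G} (hL : Summable L)
    (hT : HasFDerivAt T (∑' m, L m) x) (hI : ∀ m v, L m (I • v) = I • L m v) (v : E) :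
    dbarAlong v T x = 0 := by
  rw [dbarAlong_apply, hT.fderiv]
  have hA : ∀ w : E, (∑' m, L m) w = ∑' m, L m w := fun w => by
    have := (ContinuousLinearMap.apply ℝ G w).map_tsum hL
    simpa only [ContinuousLinearMap.apply_apply] using this
  have hs : Summable fun m => L m v := by
    have := (ContinuousLinearMap.apply ℝ G v).summable hL
    simpa only [Function.comp_def, ContinuousLinearMap.apply_apply] using this
  have h1 : (∑' m, L m) (I • v) = I • (∑' m, L m) v := by
    rw [hA, hA]
    simp_rw [hI]
    exact hs.tsum_const_smul I
  rw [h1, smul_smul, I_mul_I, neg_one_smul, add_neg_cancel, smul_zero]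

end Series

/-! ### The theorem -/

section Main

/-- An entire map into `Λ^n` composed with the type projection is `C^∞` over `ℝ`, of type `(p,0)`
everywhere, and `∂̄`-closed: `(d(g)^{p,0})^{p,1} = 0`. [folklore] -/
theorem entire_typeProj_aux {n p : ℕ} (hpn : p + 0 = n) {g : (ι → ℂ) → (ι → ℂ) [⋀^Fin n]→L[ℝ] ℂ}
    (hg : Differentiable ℂ g) :
    ContDiff ℝ ∞ (fun y => typeProjAt p 0 (g y)) ∧
      (∀ y, IsOfTypeAt p 0 (typeProjAt p 0 (g y))) ∧
      ∀ x, typeProjAt p 1 (extDeriv (fun y => typeProjAt p 0 (g y)) x) = 0 := by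
  have hPg : Differentiable ℂ fun y => typeProjAt p 0 (g y) :=
    ((typeProjL (E := ι → ℂ) (k := n) p 0).differentiable).comp hg
  have hsm : ContDiff ℝ ∞ fun y => typeProjAt p 0 (g y) := by
    have h := SCV.contDiffOn_infty hPg.differentiableOn isOpen_univ
    exact (contDiffOn_univ.1 h).restrict_scalars ℝ
  have ht : ∀ y, IsOfTypeAt p 0 (typeProjAt p 0 (g y)) := fun y => isOfTypeAt_typeProjAt hpn _
  refine ⟨hsm, ht, fun x => ?_⟩
  rw [typeProjAt_extDeriv_eq_sum ht]
  refine Finset.sum_eq_zero fun j _ => ?_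
  rw [dbarAlong_eq_zero_of_differentiableAt (hPg x), wedgeOne_zero]

/-- **`∂̄`-potentials on an exhaustion by concentric polydiscs, data of type `(p,1)`**
(Hörmander (1973), Thm. 2.7.8, case `q = 0` of the potential, for unions of increasing polydiscs
with uniform gaps): let `D_m = D(c, ρ_m)` with `ρ_m i + 2κ_m ≤ ρ_{m+1} i`, `κ_m > 0`,
`U = ⋃_m D_m`, and `α : ℂ^ι → Λ^{n+1}` be `C^∞` on `U`, of pointwise type `(p,1)` on `U` and with
`(dα)^{p,2} = 0` on `U`. Then there is `β : ℂ^ι → Λ^n`, `C^∞` on `U`, fixed by the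
`(p,0)`-projection, with `(dβ)^{p,1} = α` on `U`. Proof: exhaustion with holomorphic corrections
approximated by entire maps to increasing order (see the module docstring).
[cite: HormanderSCV1973, Thm. 2.7.8] -/
theorem exists_dbar_potential_on_exhaustion_zero {n p : ℕ} {c : ι → ℂ} {ρ : ℕ → ι → ℝ}
    {κ : ℕ → ℝ} (hκ0 : ∀ m, 0 < κ m) (hρκ : ∀ m i, ρ m i + κ m + κ m ≤ ρ (m + 1) i)
    {α : (ι → ℂ) → (ι → ℂ) [⋀^Fin (n + 1)]→L[ℝ] ℂ} (hα : ContDiffOn ℝ ∞ α (⋃ m, polydisc c (ρ m)))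
    (htype : ∀ x ∈ ⋃ m, polydisc c (ρ m), IsOfTypeAt p 1 (α x))
    (hclosed : ∀ x ∈ ⋃ m, polydisc c (ρ m), typeProjAt p 2 (extDeriv α x) = 0) :
    ∃ β : (ι → ℂ) → (ι → ℂ) [⋀^Fin n]→L[ℝ] ℂ, ContDiffOn ℝ ∞ β (⋃ m, polydisc c (ρ m)) ∧
      (∀ x, typeProjAt p 0 (β x) = β x) ∧
      ∀ x ∈ ⋃ m, polydisc c (ρ m), typeProjAt p 1 (extDeriv β x) = α x := by
  classical
  -- empty union: nothing to do; otherwise the degree is `n = p`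
  by_cases hne : (⋃ m, polydisc c (ρ m)).Nonempty
  swap
  · refine ⟨0, contDiffOn_const, fun x => by simp, fun x hx => ?_⟩
    exact absurd ⟨x, hx⟩ hne
  obtain ⟨x₀, hx₀⟩ := hne
  have hpn : p + 0 = n := by have := (htype x₀ hx₀).1; omega
  -- the exhaustion and the gaps
  have hρm : ∀ m i, ρ m i < ρ (m + 1) i := fun m i => by
    have := hρκ m i; have := hκ0 m; linarith
  have hρle : ∀ {m m' : ℕ}, m ≤ m' → ∀ i, ρ m i ≤ ρ m' i := by
    intro m m' h i
    induction h with
    | refl => exact le_rfl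
    | step _ ih => exact ih.trans (hρm _ i).le
  have hDU : ∀ m, polydisc c (ρ m) ⊆ ⋃ m, polydisc c (ρ m) := fun m =>
    subset_iUnion (fun m => polydisc c (ρ m)) m
  -- closed polydiscs of radii `ρ m` lie in the open polydiscs of radii `ρ m'`, `m < m'`
  have hclosed_sub : ∀ {m m' : ℕ}, m < m' →
      Set.pi univ (fun i => closedBall (c i) (ρ m i)) ⊆ polydisc c (ρ m') := by
    intro m m' h y hy
    exact mem_polydisc.2 fun i => mem_ball.2
      ((mem_closedBall.1 (hy i (mem_univ i))).trans_lt ((hρm m i).trans_le (hρle h i)))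
  have hopen_sub : ∀ m, polydisc c (ρ m) ⊆ Set.pi univ (fun i => closedBall (c i) (ρ m i)) :=
    fun m y hy i _ => ball_subset_closedBall (mem_polydisc.1 hy i)
  -- potentials on the `D_m` (Thm. 2.3.3 in bidegree `(p,1)`)
  have hex : ∀ m, ∃ β : (ι → ℂ) → (ι → ℂ) [⋀^Fin n]→L[ℝ] ℂ, ContDiff ℝ ∞ β ∧
      (∀ x, typeProjAt p 0 (β x) = β x) ∧
      ∀ x ∈ polydisc c (ρ m), typeProjAt p 1 (extDeriv β x) = α x := fun m =>
    exists_dbar_potential_of_type (q := 0) (hρm m) (hα.mono (hDU (m + 1)))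
      (fun x hx => htype x (hDU (m + 1) hx)) (fun x hx => hclosed x (hDU (m + 1) hx))
  choose B hB₁ hB₂ hB₃ using hex
  -- invariant, smallness, and the correction step
  let Inv : ℕ → ((ι → ℂ) → (ι → ℂ) [⋀^Fin n]→L[ℝ] ℂ) → Prop := fun m β =>
    ContDiff ℝ ∞ β ∧ (∀ x, typeProjAt p 0 (β x) = β x) ∧
      ∀ x ∈ polydisc c (ρ (m + 1)), typeProjAt p 1 (extDeriv β x) = α x
  let Good : ℕ → ((ι → ℂ) → (ι → ℂ) [⋀^Fin n]→L[ℝ] ℂ) → Prop := fun m u =>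
    DifferentiableOn ℂ u (polydisc c (ρ (m + 1))) ∧
      ∀ j ≤ m + 1, ∀ x ∈ Set.pi univ (fun i => closedBall (c i) (ρ m i)),
        ‖iteratedFDeriv ℝ j u x‖ ≤ (1 / 2 : ℝ) ^ m
  have corr : ∀ m β, Inv m β → ∃ β', Inv (m + 1) β' ∧ Good m (fun x => β' x - β x) := by
    rintro m β ⟨hβ₁, hβ₂, hβ₃⟩
    -- `δ = B (m+2) - β` is a smooth `(p,0)`-form, `∂̄`-closed hence holomorphic on `D_{m+1}`
    set δ : (ι → ℂ) → (ι → ℂ) [⋀^Fin n]→L[ℝ] ℂ := fun x => B (m + 2) x - β x with hδ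
    have hδs : ContDiff ℝ ∞ δ := (hB₁ (m + 2)).sub hβ₁
    have hδf : ∀ x, typeProjAt p 0 (δ x) = δ x := fun x => by
      simp only [hδ, typeProjAt_sub, hB₂, hβ₂]
    have hδt : ∀ x, IsOfTypeAt p 0 (δ x) := fun x =>
      (isOfTypeAt_iff_typeProjAt_eq_self hpn _).2 (hδf x)
    have hδc : ∀ x ∈ polydisc c (ρ (m + 1)), typeProjAt p 1 (extDeriv δ x) = 0 := by
      intro x hx
      rw [hδ, extDeriv_sub_apply (((hB₁ (m + 2)).differentiable (by simp)).differentiableAt)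
        ((hβ₁.differentiable (by simp)).differentiableAt), typeProjAt_sub,
        hB₃ (m + 2) x (polydisc_mono c (fun i => (hρm (m + 1) i).le) hx), hβ₃ x hx, sub_self]
    have hδhol : DifferentiableOn ℂ δ (polydisc c (ρ (m + 1))) :=
      differentiableOn_complex_of_typeZero (isOpen_polydisc _ _)
        ((hδs.differentiable (by simp)).differentiableOn) hδt hδc
    -- entire approximation to order `m + 1` within `(1/2)^m` on the closed polydisc of radii `ρ m`
    obtain ⟨g, hg, hgb⟩ := exists_entire_correction (p := p) (t := ρ m) hδhol hδf (hκ0 m)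
      (fun i => by have := hρκ m i; have := hκ0 m; linarith) (m + 1)
      (pow_pos (by norm_num : (0 : ℝ) < 1 / 2) m)
    obtain ⟨hPs, hPt, hPc⟩ := entire_typeProj_aux (ι := ι) hpn hg
    refine ⟨fun x => B (m + 2) x - typeProjAt p 0 (g x), ⟨?_, ?_, ?_⟩, ?_, ?_⟩
    · exact (hB₁ (m + 2)).sub hPs
    · intro x
      simp only [typeProjAt_sub, hB₂, typeProjAt_typeProjAt_self]
    · intro x hx
      rw [extDeriv_sub_apply (((hB₁ (m + 2)).differentiable (by simp)).differentiableAt)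
        ((hPs.differentiable (by simp)).differentiableAt), typeProjAt_sub, hB₃ (m + 2) x hx, hPc x,
        sub_zero]
    · -- holomorphy of the difference `δ - (g)^{p,0}` on `D_{m+1}`
      have : (fun x => B (m + 2) x - typeProjAt p 0 (g x) - β x) =
          fun x => δ x - typeProjAt p 0 (g x) := by
        funext x; simp only [hδ]; abel
      rw [this]
      exact hδhol.sub ((((typeProjL (E := ι → ℂ) (k := n) p 0).differentiable).comp hg).differentiableOn)
    · intro j hj x hx
      have : (fun x => B (m + 2) x - typeProjAt p 0 (g x) - β x) =
          fun x => δ x - typeProjAt p 0 (g x) := by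
        funext x; simp only [hδ]; abel
      rw [this]
      exact hgb j hj x hx
  -- the corrected sequence and its increments
  have inv0 : Inv 0 (B 1) := ⟨hB₁ 1, hB₂ 1, hB₃ 1⟩
  let S : ∀ m : ℕ, {β // Inv m β} := fun m =>
    Nat.rec (motive := fun m => {β // Inv m β}) ⟨B 1, inv0⟩
      (fun m s => ⟨Classical.choose (corr m s.1 s.2), (Classical.choose_spec (corr m s.1 s.2)).1⟩) m
  set u : ℕ → (ι → ℂ) → (ι → ℂ) [⋀^Fin n]→L[ℝ] ℂ := fun m x => (S (m + 1)).1 x - (S m).1 x with hu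
  have hGood : ∀ m, Good m (u m) := fun m =>
    (Classical.choose_spec (corr m (S m).1 (S m).2)).2
  have hus : ∀ m, ContDiff ℝ ∞ (u m) := fun m => (S (m + 1)).2.1.sub (S m).2.1
  have huf : ∀ m x, typeProjAt p 0 (u m x) = u m x := fun m x => by
    simp only [hu, typeProjAt_sub, (S (m + 1)).2.2.1, (S m).2.2.1]
  have tele : ∀ k x, (S k).1 x = (S 0).1 x + ∑ m ∈ Finset.range k, u m x := by
    intro k x
    induction k with
    | zero => simp
    | succ k ih => rw [Finset.sum_range_succ, ← add_assoc, ← ih]; simp only [hu]; abel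
  -- the potential: the pointwise limit
  let β : (ι → ℂ) → (ι → ℂ) [⋀^Fin n]→L[ℝ] ℂ := fun x => (S 0).1 x + ∑' m, u m x
  have hβf : ∀ x, typeProjAt p 0 (β x) = β x := by
    intro x
    simp only [β]
    rw [typeProjAt_add, (S 0).2.2.1]
    congr 1
    by_cases hsx : Summable fun m => u m x
    · rw [← typeProjL_apply, (typeProjL (E := ι → ℂ) (k := n) p 0).map_tsum hsx]
      simp only [typeProjL_apply, huf]
    · rw [tsum_eq_zero_of_not_summable hsx, typeProjAt_zero]
  -- local structure on `D_k`: `β = S (k+1) + T_k` with `T_k` a smooth cut-off series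
  have local_repr : ∀ k, (∀ i, 0 < ρ k i) →
      ∃ T : (ι → ℂ) → (ι → ℂ) [⋀^Fin n]→L[ℝ] ℂ, ContDiff ℝ ∞ T ∧
        (∀ x ∈ polydisc c (ρ k), β x = (S (k + 1)).1 x + T x) ∧
        ∀ x ∈ polydisc c (ρ k), typeProjAt p 1 (extDeriv T x) = 0 := by
    intro k hk
    -- cut-off equal to `1` on the closed polydisc `ρ k`, supported in the closed polydisc `ρ (k+1)`
    obtain ⟨χ, hχ, hχc, hχsupp, hχ1, -⟩ := exists_polydisc_cutoff c hk (fun i => hρm k i)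
    set K : Set (ι → ℂ) := Set.pi univ (fun i => closedBall (c i) (ρ (k + 1) i)) with hK
    -- the shifted family and its bounds on `K`
    set v : ℕ → (ι → ℂ) → (ι → ℂ) [⋀^Fin n]→L[ℝ] ℂ := fun m => u (m + (k + 1)) with hv
    have hvb : ∀ m, ∀ i ≤ m + 1, ∀ x ∈ K, ‖iteratedFDeriv ℝ i (v m) x‖ ≤ (1 / 2 : ℝ) ^ (m + (k + 1)) := by
      intro m i hi x hx
      refine (hGood (m + (k + 1))).2 i (by omega) x fun i' _ => ?_
      exact closedBall_subset_closedBall (hρle (by omega) i') (hx i' (mem_univ i'))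
    have ha : Summable fun m : ℕ => (1 / 2 : ℝ) ^ (m + (k + 1)) := by
      simp_rw [pow_add]
      exact (summable_geometric_of_lt_one (by norm_num) (by norm_num)).mul_right _
    obtain ⟨hT, hT0, hT1, hTd⟩ := contDiff_tsum_smul_cutoff (fun m => hus (m + (k + 1))) hχ hχc hχsupp
      ha (fun m => by positivity) hvb
    refine ⟨fun x => ∑' m, χ x • v m x, hT, fun x hx => ?_, fun x hx => ?_⟩
    · -- on `D_k`: `χ = 1`, the series of `u` converges, reindex
      have hx1 : χ x = 1 := hχ1 x (hopen_sub k hx)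
      have hsum : Summable fun m => u m x := by
        refine Summable.of_norm_bounded_eventually_nat
          (summable_geometric_of_lt_one (by norm_num : (0:ℝ) ≤ 1 / 2) (by norm_num)) ?_
        rw [eventually_atTop]
        refine ⟨k + 1, fun m hm => ?_⟩
        have h0 := (hGood m).2 0 (Nat.zero_le _) x fun i _ =>
          closedBall_subset_closedBall (hρle (by omega) i) (ball_subset_closedBall (mem_polydisc.1 hx i))
        rwa [norm_iteratedFDeriv_zero] at h0
      simp only [β, hx1, one_smul, hv]
      rw [tele (k + 1) x, add_assoc, hsum.sum_add_tsum_nat_add (k + 1)]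
    · -- `∂̄ T = 0` on `D_k`: the derivative is the sum of derivatives of maps holomorphic at `x`
      have hTt : ∀ y, IsOfTypeAt p 0 (∑' m, χ y • v m y) := by
        intro y
        refine (isOfTypeAt_iff_typeProjAt_eq_self hpn _).2 ?_
        rw [← typeProjL_apply, (typeProjL (E := ι → ℂ) (k := n) p 0).map_tsum (hT0 y)]
        simp only [map_smul, typeProjL_apply, hv, huf]
      rw [typeProjAt_extDeriv_eq_sum hTt]
      refine Finset.sum_eq_zero fun j _ => ?_
      rw [dbarAlong_eq_zero_of_hasFDerivAt_tsum (hT1 x) (hTd x) (fun m w => ?_), wedgeOne_zero]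
      -- each `χ • v m` agrees with the holomorphic `v m` near `x`
      have hxk : x ∈ polydisc c (ρ (m + (k + 1) + 1)) :=
        polydisc_mono c (fun i => hρle (by omega) i) hx
      have hhol : DifferentiableAt ℂ (v m) x :=
        ((hGood (m + (k + 1))).1.differentiableAt ((isOpen_polydisc _ _).mem_nhds hxk))
      have hev : (fun y => χ y • v m y) =ᶠ[𝓝 x] v m := by
        filter_upwards [(isOpen_polydisc c (ρ k)).mem_nhds hx] with y hy
        rw [hχ1 y (hopen_sub k hy), one_smul]
      have hholχ : DifferentiableAt ℂ (fun y => χ y • v m y) x := hhol.congr_of_eventuallyEq hev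
      rw [hholχ.fderiv_restrictScalars ℝ]
      simp
  refine ⟨β, fun x hx => ?_, hβf, fun x hx => ?_⟩
  · -- smoothness on `U`
    obtain ⟨k, hk⟩ := mem_iUnion.1 hx
    have hkpos : ∀ i, 0 < ρ k i := fun i => (dist_nonneg).trans_lt (mem_ball.1 (mem_polydisc.1 hk i))
    obtain ⟨T, hT, hβT, -⟩ := local_repr k hkpos
    have hev : β =ᶠ[𝓝 x] fun y => (S (k + 1)).1 y + T y :=
      Filter.eventuallyEq_of_mem ((isOpen_polydisc c (ρ k)).mem_nhds hk) hβT
    exact ((((S (k + 1)).2.1.add hT).contDiffAt).congr_of_eventuallyEq hev).contDiffWithinAt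
  · -- the equation on `U`
    obtain ⟨k, hk⟩ := mem_iUnion.1 hx
    have hkpos : ∀ i, 0 < ρ k i := fun i => (dist_nonneg).trans_lt (mem_ball.1 (mem_polydisc.1 hk i))
    obtain ⟨T, hT, hβT, hTc⟩ := local_repr k hkpos
    have hev : β =ᶠ[𝓝 x] fun y => (S (k + 1)).1 y + T y :=
      Filter.eventuallyEq_of_mem ((isOpen_polydisc c (ρ k)).mem_nhds hk) hβT
    rw [hev.extDeriv_eq, show (fun y => (S (k + 1)).1 y + T y) = (S (k + 1)).1 + T from rfl,
      extDeriv_add (((S (k + 1)).2.1.differentiable (by simp)).differentiableAt)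
      ((hT.differentiable (by simp)).differentiableAt), typeProjAt_add,
      (S (k + 1)).2.2.2 x (polydisc_mono c (fun i => hρle (by omega) i) hk), hTc x hk, add_zero]

/-- **`∂̄`-potentials on a whole polydisc for data of type `(p,1)`** (Hörmander (1973), Thm. 2.7.8
for polydiscs, case `q = 0`): the exhaustion `D(c,r) = ⋃_m D(c, r - 1/(m+1))` (gaps
`1/(m+1) - 1/(m+2)`). [cite: HormanderSCV1973, Thm. 2.7.8] -/
theorem exists_dbar_potential_on_polydisc_zero {n p : ℕ} {c : ι → ℂ} {r : ι → ℝ}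
    {α : (ι → ℂ) → (ι → ℂ) [⋀^Fin (n + 1)]→L[ℝ] ℂ} (hα : ContDiffOn ℝ ∞ α (polydisc c r))
    (htype : ∀ x ∈ polydisc c r, IsOfTypeAt p 1 (α x))
    (hclosed : ∀ x ∈ polydisc c r, typeProjAt p 2 (extDeriv α x) = 0) :
    ∃ β : (ι → ℂ) → (ι → ℂ) [⋀^Fin n]→L[ℝ] ℂ, ContDiffOn ℝ ∞ β (polydisc c r) ∧
      (∀ x, typeProjAt p 0 (β x) = β x) ∧
      ∀ x ∈ polydisc c r, typeProjAt p 1 (extDeriv β x) = α x := by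
  have hκ0 : ∀ m : ℕ, (0 : ℝ) < (1 / ((m : ℝ) + 1) - 1 / ((m : ℝ) + 2)) / 2 := fun m => by
    have : (1 : ℝ) / ((m : ℝ) + 2) < 1 / ((m : ℝ) + 1) :=
      one_div_lt_one_div_of_lt (by positivity) (by linarith)
    linarith
  have hρκ : ∀ (m : ℕ) (i : ι), r i - 1 / ((m : ℝ) + 1) + (1 / ((m : ℝ) + 1) - 1 / ((m : ℝ) + 2)) / 2 +
      (1 / ((m : ℝ) + 1) - 1 / ((m : ℝ) + 2)) / 2 ≤ r i - 1 / (((m + 1 : ℕ) : ℝ) + 1) := by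
    intro m i; push_cast; ring_nf; exact le_rfl
  rw [← iUnion_polydisc_sub c r] at hα htype hclosed ⊢
  exact exists_dbar_potential_on_exhaustion_zero (ρ := fun m i => r i - 1 / ((m : ℝ) + 1)) hκ0 hρκ hα
    htype hclosed

/-- **`∂̄`-potentials on all of `ℂ^ι` for data of type `(p,1)`** (Hörmander (1973), Thm. 2.7.8
for `Ω = ℂⁿ`, case `q = 0`): a `C^∞` form `α : ℂ^ι → Λ^{n+1}` of type `(p,1)` with
`(dα)^{p,2} = 0` is `(dβ)^{p,1}` for a `C^∞` form `β` of type `(p,0)` (the exhaustion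
`ℂ^ι = ⋃_m D(0, m+1)`, gaps `1/2`). [cite: HormanderSCV1973, Thm. 2.7.8] -/
theorem exists_dbar_potential_on_univ_zero {n p : ℕ}
    {α : (ι → ℂ) → (ι → ℂ) [⋀^Fin (n + 1)]→L[ℝ] ℂ} (hα : ContDiff ℝ ∞ α)
    (htype : ∀ x, IsOfTypeAt p 1 (α x)) (hclosed : ∀ x, typeProjAt p 2 (extDeriv α x) = 0) :
    ∃ β : (ι → ℂ) → (ι → ℂ) [⋀^Fin n]→L[ℝ] ℂ, ContDiff ℝ ∞ β ∧
      (∀ x, typeProjAt p 0 (β x) = β x) ∧ ∀ x, typeProjAt p 1 (extDeriv β x) = α x := by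
  have hU := iUnion_polydisc_nat (ι := ι) (0 : ι → ℂ)
  obtain ⟨β, hβ, hβf, hβα⟩ := exists_dbar_potential_on_exhaustion_zero (c := (0 : ι → ℂ))
    (ρ := fun m _ => (m : ℝ) + 1) (κ := fun _ => 1 / 2) (p := p) (fun _ => by norm_num)
    (fun m i => by push_cast; linarith) (by rw [hU]; exact hα.contDiffOn) (fun x _ => htype x)
    (fun x _ => hclosed x)
  rw [hU] at hβ hβα
  exact ⟨β, contDiffOn_univ.1 hβ, hβf, fun x => hβα x (mem_univ x)⟩

end Main

end Literature.Analysis.Complex
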